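import Literature.Computability.AlgebraicComplexity.TransferRecursion
import Mathlib.Analysis.SpecialFunctions.Exp
import HarnessLib

/-!
# The transfer recursion with weights slightly above `1` (Kumar–Saraf 2017, §9.3, Claim 9.7)

Topic `Literature/Computability/AlgebraicComplexity`; a complement to `TransferRecursion.lean` for
the `T₃` bounds of the printed proof of `kumarSaraf2017_imm_homDepthFour`. There the per-agreement
factor is `E = (N-k)/m = D/(D-1)` instead of `D`, so the middle weights `E/2 = (1-δ)/(1-2δ)` exceed
`1` slightly and the bounds of `TransferRecursion.lean` (middle weights `≤ 1 - δ`) do not apply.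
Instead we bound the two-state recursion `a_{j+1} = w_j (a_j + c b_j)`, `b_{j+1} = a_j + b_j`
through the largest weight of an interval of layers, `G ≥ ∏_{i ≤ l < j} w_l`:

* `aSeq_eq_unroll` — the exact solution
  `a_j = [init] ∏_{l<j} w_l + c ∑_{i<j} (∏_{i ≤ l < j} w_l) b_i`;
* `tSeq_succ_le_growth` — `T_{j+1} (1 - cGk) ≤ T_j + [init] ∏_{l ≤ j} w_l`;
* **`tSeq_le_growth_diffStart`** — `T_k(false) ≤ (1 + 2cGk)^k` when `cGk ≤ 1/2`
  (every run charged: the different-start sum is `1 + o(1)` as soon as `c G k² = o(1)`);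
* **`tSeq_le_growth_sameStart`** — `T_k(true) ≤ (1 + 2cGk)^k (1 + ∑_{1 ≤ j ≤ k} ∏_{l<j} w_l)`
  (the uncharged initial run contributes its own weight);
* `one_add_pow_le_of_mul_le` — `(1 + y)^k ≤ 1 + 2ky` for `0 ≤ y`, `ky ≤ 1/2`.

Everything is proved; no named facts.

## References

* M. Kumar, S. Saraf, *On the power of homogeneous depth 4 arithmetic circuits*, SIAM J. Comput.
  46 (2017) 336–387 (arXiv:1404.1950): §9.3, Claim 9.7.
-/

noncomputable section

namespace Literature.Computability.AlgebraicComplexity.KumarSaraf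

open Finset

variable {w : ℕ → ℝ} {c : ℝ} (init : Bool)

/-- **The exact solution of the transfer recursion**:
`a_j = [init] ∏_{l<j} w_l + c ∑_{i<j} (∏_{i ≤ l < j} w_l) b_i`. [cite: KumarSaraf2017, Lemma 9.2] -/
theorem aSeq_eq_unroll (w : ℕ → ℝ) (c : ℝ) (init : Bool) (j : ℕ) :
    aSeq w c init j = (if init then ∏ l ∈ range j, w l else 0) +
      c * ∑ i ∈ range j, (∏ l ∈ Ico i j, w l) * aSeq.bSeq w c init i := by
  induction j with
  | zero => simp
  | succ j ih =>
    rw [aSeq_succ, ih, sum_range_succ, prod_range_succ, Nat.Ico_succ_singleton, prod_singleton]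
    have hI : ∑ i ∈ range j, (∏ l ∈ Ico i (j + 1), w l) * aSeq.bSeq w c init i =
        w j * ∑ i ∈ range j, (∏ l ∈ Ico i j, w l) * aSeq.bSeq w c init i := by
      rw [mul_sum]
      refine sum_congr rfl fun i hi => ?_
      rw [prod_Ico_succ_top (mem_range.1 hi).le]
      ring
    rw [hI]
    split_ifs <;> ring

/-- **One step with interval growth `G`**: if `∏_{i ≤ l < j+1} w_l ≤ G` for all `i ≤ j`, then
`T_{j+1} ≤ T_j + [init] ∏_{l ≤ j} w_l + c G (j+1) T_{j+1}`. [cite: KumarSaraf2017, Claim 9.7] -/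
theorem tSeq_succ_le_growth (hw : ∀ j, 0 ≤ w j) (hc : 0 ≤ c) {G : ℝ}
    (j : ℕ) (hG : ∀ i, i ≤ j → ∏ l ∈ Ico i (j + 1), w l ≤ G) :
    tSeq w c init (j + 1) ≤ tSeq w c init j + (if init then ∏ l ∈ range (j + 1), w l else 0) +
      c * G * (j + 1) * tSeq w c init (j + 1) := by
  have hT : tSeq w c init (j + 1) = tSeq w c init j + aSeq w c init (j + 1) := tSeq_succ w c init j
  have ha := aSeq_eq_unroll w c init (j + 1)
  have hmono := tSeq_mono init hw hc
  have hb : ∀ i ∈ range (j + 1), (∏ l ∈ Ico i (j + 1), w l) * aSeq.bSeq w c init i ≤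
      G * tSeq w c init (j + 1) := by
    intro i hi
    have hi' := mem_range.1 hi
    have hbi : aSeq.bSeq w c init i ≤ tSeq w c init i := by
      unfold tSeq; linarith [(aSeq_nonneg init hw hc i).1]
    have hbi0 : 0 ≤ aSeq.bSeq w c init i := (aSeq_nonneg init hw hc i).2
    calc (∏ l ∈ Ico i (j + 1), w l) * aSeq.bSeq w c init i ≤ G * aSeq.bSeq w c init i :=
          mul_le_mul_of_nonneg_right (hG i (by omega)) hbi0
      _ ≤ G * tSeq w c init (j + 1) := by
          have hG0 : 0 ≤ G := le_trans (prod_nonneg fun l _ => hw l) (hG i (by omega))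
          exact mul_le_mul_of_nonneg_left (hbi.trans (hmono (by omega))) hG0
  have hsum : ∑ i ∈ range (j + 1), (∏ l ∈ Ico i (j + 1), w l) * aSeq.bSeq w c init i ≤
      (j + 1 : ℝ) * (G * tSeq w c init (j + 1)) := by
    calc _ ≤ ∑ _i ∈ range (j + 1), G * tSeq w c init (j + 1) := sum_le_sum hb
      _ = _ := by rw [sum_const, card_range, nsmul_eq_mul]; push_cast; ring
  have := mul_le_mul_of_nonneg_left hsum hc
  have haj : aSeq w c init (j + 1) ≤ (if init then ∏ l ∈ range (j + 1), w l else 0) +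
      c * G * (j + 1) * tSeq w c init (j + 1) := by
    rw [ha]; linarith
  linarith

/-- **Iterating**: with `x = cGk ≤ 1/2` and `G` bounding all interval products up to `k`,
`T_j ≤ (1 + 2x)^j (1 + ∑_{1 ≤ i ≤ j} [init] ∏_{l<i} w_l)` for `j ≤ k`. [cite: KumarSaraf2017, Claim 9.7] -/
theorem tSeq_le_growth (hw : ∀ j, 0 ≤ w j) (hc : 0 ≤ c) {G : ℝ} {k : ℕ}
    (hG : ∀ i j, i ≤ j → j ≤ k → ∏ l ∈ Ico i j, w l ≤ G) (hx : c * G * k ≤ 1 / 2) :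
    ∀ j, j ≤ k → tSeq w c init j ≤ (1 + 2 * (c * G * k)) ^ j *
      (1 + ∑ i ∈ Ico 1 (j + 1), if init then ∏ l ∈ range i, w l else 0) := by
  have hG0 : 0 ≤ G := le_trans (by simp) (hG 0 0 le_rfl (Nat.zero_le _))
  set x := c * G * k with hxdef
  have hx0 : 0 ≤ x := by rw [hxdef]; positivity
  intro j
  induction j with
  | zero => intro; simp
  | succ j ih =>
    intro hjk
    have ih' := ih (Nat.le_of_succ_le hjk)
    have hstep := tSeq_succ_le_growth init hw hc j (fun i hi => hG i (j + 1) (by omega) hjk)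
    set W := (if init then ∏ l ∈ range (j + 1), w l else (0 : ℝ)) with hW
    have hW0 : 0 ≤ W := by rw [hW]; split_ifs; exacts [prod_nonneg fun l _ => hw l, le_rfl]
    -- `T_{j+1} (1 - x) ≤ T_j + W`
    have hcoef : c * G * (j + 1 : ℝ) ≤ x := by
      rw [hxdef]
      refine mul_le_mul_of_nonneg_left ?_ (by positivity)
      exact_mod_cast hjk
    have hT0 : 0 ≤ tSeq w c init (j + 1) := le_trans zero_le_one (one_le_tSeq init hw hc _)
    have h1 : tSeq w c init (j + 1) * (1 - x) ≤ tSeq w c init j + W := by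
      have := mul_le_mul_of_nonneg_right hcoef hT0
      nlinarith
    -- `1/(1-x) ≤ 1 + 2x`
    have h2 : tSeq w c init (j + 1) ≤ (1 + 2 * x) * (tSeq w c init j + W) := by
      have hx1 : x ≤ 1 / 2 := hx
      nlinarith [mul_nonneg hx0 hT0, mul_nonneg hx0 (mul_nonneg hx0 hT0)]
    -- combine with the induction hypothesis
    have hsum : ∑ i ∈ Ico 1 (j + 1 + 1), (if init then ∏ l ∈ range i, w l else (0 : ℝ)) =
        (∑ i ∈ Ico 1 (j + 1), if init then ∏ l ∈ range i, w l else (0 : ℝ)) + W := by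
      rw [sum_Ico_succ_top (by omega), hW]
    rw [hsum, pow_succ]
    have hS0 : 0 ≤ ∑ i ∈ Ico 1 (j + 1), (if init then ∏ l ∈ range i, w l else (0 : ℝ)) :=
      sum_nonneg fun i _ => by split_ifs; exacts [prod_nonneg fun l _ => hw l, le_rfl]
    have hpow1 : 1 ≤ (1 + 2 * x) ^ j := one_le_pow₀ (by linarith)
    calc tSeq w c init (j + 1) ≤ (1 + 2 * x) * (tSeq w c init j + W) := h2
      _ ≤ (1 + 2 * x) * ((1 + 2 * x) ^ j *
          (1 + ∑ i ∈ Ico 1 (j + 1), (if init then ∏ l ∈ range i, w l else (0 : ℝ))) +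
            (1 + 2 * x) ^ j * W) := by
          refine mul_le_mul_of_nonneg_left (add_le_add ih' ?_) (by linarith)
          exact le_mul_of_one_le_left hW0 hpow1
      _ = _ := by ring

/-- **Different starts, growth case** ([KS, Claim 9.7]): `T_k(false) ≤ (1 + 2cGk)^k`.
[cite: KumarSaraf2017, Claim 9.7] -/
theorem tSeq_le_growth_diffStart (hw : ∀ j, 0 ≤ w j) (hc : 0 ≤ c) {G : ℝ} {k : ℕ}
    (hG : ∀ i j, i ≤ j → j ≤ k → ∏ l ∈ Ico i j, w l ≤ G) (hx : c * G * k ≤ 1 / 2) :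
    ∑ A ∈ (range k).powerset, runWeight w c false A ≤ (1 + 2 * (c * G * k)) ^ k := by
  rw [sum_runWeight_eq]
  have h := tSeq_le_growth false hw hc hG hx k le_rfl
  simp only [if_false, sum_const_zero, add_zero, mul_one, Bool.false_eq_true] at h
  exact h

/-- **Same start, growth case** ([KS, §9.3]): `T_k(true) ≤ (1 + 2cGk)^k (1 + ∑_{1≤j≤k} ∏_{l<j} w_l)`
— the uncharged initial run of agreements contributes its own weight. [cite: KumarSaraf2017, Claim 9.7] -/
theorem tSeq_le_growth_sameStart (hw : ∀ j, 0 ≤ w j) (hc : 0 ≤ c) {G : ℝ} {k : ℕ}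
    (hG : ∀ i j, i ≤ j → j ≤ k → ∏ l ∈ Ico i j, w l ≤ G) (hx : c * G * k ≤ 1 / 2) :
    ∑ A ∈ (range k).powerset, runWeight w c true A ≤
      (1 + 2 * (c * G * k)) ^ k * (1 + ∑ j ∈ Ico 1 (k + 1), ∏ l ∈ range j, w l) := by
  rw [sum_runWeight_eq]
  have h := tSeq_le_growth true hw hc hG hx k le_rfl
  simp only [if_true] at h
  exact h

/-- `(1 + y)^k ≤ 1 + 2ky` for `0 ≤ y` and `ky ≤ 1/2` (via `(1+y)^k ≤ e^{ky} ≤ 1 + ky + (ky)²`).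
[folklore] -/
theorem one_add_pow_le_of_mul_le {y : ℝ} (hy : 0 ≤ y) {k : ℕ} (hky : k * y ≤ 1 / 2) :
    (1 + y) ^ k ≤ 1 + 2 * (k * y) := by
  have h1 : (1 + y) ^ k ≤ Real.exp (k * y) := by
    calc (1 + y) ^ k ≤ (Real.exp y) ^ k := by
          refine pow_le_pow_left₀ (by linarith) ?_ k
          have := Real.add_one_le_exp y
          linarith
      _ = Real.exp (k * y) := by rw [← Real.exp_nat_mul]
  have hky0 : 0 ≤ (k : ℝ) * y := by positivity
  have h2 : |Real.exp (k * y) - 1 - k * y| ≤ (k * y) ^ 2 :=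
    Real.abs_exp_sub_one_sub_id_le (by rw [abs_of_nonneg hky0]; linarith)
  have h3 : Real.exp (k * y) ≤ 1 + k * y + (k * y) ^ 2 := by
    have := (abs_le.1 h2).2; linarith
  nlinarith

end Literature.Computability.AlgebraicComplexity.KumarSaraf

end
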